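import Literature.Barriers.CriticalPhenomena.WeaklySAWFourDimLogCorrectionsChangeOfParameters
import HarnessLib

/-!
# BBS 2015, Theorem 1.2 (`ν_c(g) = -ag + O(g²)`): the renormalisation-group half, reduced to
# Theorem 4.1 with the §8.5 asymptotics of the critical initial condition `ν₀ᶜ(0, g₀)`

Companion to `WeaklySAWFourDimLogCorrections.lean` (named fact `CTWSAW.BBS2015_thm12` =
Theorem 1.2 of Bauerschmidt–Brydges–Slade, CMP 337 (2015), arXiv:1403.7422; its lower inequality
is Lemma A.1's `d > 2` clause, its upper inequality is the named fact `CTWSAW.BBS2015_thm12_upper`)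
and to `WeaklySAWFourDimLogCorrectionsReduction.lean` / `…ChangeOfParameters.lean`, which vendor
**Theorem 4.1** as the predicate `CTWSAW.Thm41Data δ K ν₀ᶜ z₀ᶜ c` on the renormalised susceptibility
`CTWSAW.chiHat` (defined there through the printed identity `χ(g,ν) = (1+z₀)χ̂(m²,g₀,ν₀,z₀)`) and
PROVE Proposition 4.2(ii) from it and Lemma A.1 (`CTWSAW.BBS2015_prop42ii_of_lemA1`).

## What the source prints (§8.5, "Proof of Theorem 1.2", p. 36 of the held text)

"Let `g₀ = g̃₀(g,0)`, with `g̃₀` the function of Proposition 4.2(ii). Let `ν₀ᶜ, z₀ᶜ` be given by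
`μ₀ᶜ, z₀ᶜ` of Proposition 7.1. By (4.x) [`g = g₀/(1+z₀)²`, `ν = (ν₀+m²)/(1+z₀)` at `m² = 0`],
`ν_c(g) = ν₀ᶜ(0,g₀)/(1 + z₀ᶜ(0,g₀)) = ν₀ᶜ(0,g₀) + O(g₀²)`. Since `g₀ = g + O(g²)` by Proposition 4.2,
it suffices to show that `μ₀ᶜ(0,g₀) = -2C(0)g₀ + O(g₀²) = -ag₀ + O(g₀²)` (all covariances have
`m² = 0` in this proof)." The rest of §8.5 proves the latter from the flow equations of
Proposition 7.1 (`μ̌_{j+1} = L²μ̌_j(1 - γβ_jǧ_j) + η_jǧ_j + O(χ_jḡ_j²)`, `η_j = 2L^{2(j+1)}C_{j+1;0,0}` from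
[BBS-rg-pt], `Σ_l C_{l+1;0,0} = C(0)`), ending with "`μ̌₀ = -2C(0)g₀ + O(g₀²)`, and the proof is
complete."

## What this file does

* `CTWSAW.BBS2015_thm41_nu0c` — named fact (NOT proved): Theorem 4.1 TOGETHER WITH the §8.5
  asymptotics of the same critical initial condition, `ν₀ᶜ(0,g₀) = -2C₀(0)g₀ + O(g₀²)`
  (`C₀(0) = greenZero 4`; `C(0)` of §8.5 is `C_{m²=0}(0) = C₀(0)` of §1.2). Bundled existentially,
  because in print the asymptotics is a property of the SPECIFIC functions `ν₀ᶜ = μ₀ᶜ, z₀ᶜ` of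
  Proposition 7.1 for which Theorem 4.1 is established (§8.4), proved from the renormalisation-group
  flow — not a consequence of the conclusions of Theorem 4.1 alone. This is the irreducible
  renormalisation-group input of Theorem 1.2 (Sections 5–8 and the companion series
  [BS-rg-norm, BS-rg-loc, BBS-rg-pt, BS-rg-IE, BS-rg-step]); it implies `BBS2015_thm41`.
* PROVED, `CTWSAW.BBS2015_thm12_of_thm41_nu0c`: Theorem 1.2 from `BBS2015_thm41_nu0c` and
  Proposition 4.2(ii) (`BBS2015_prop42ii`) — the displayed computation of §8.5: at `ε = 0`
  Proposition 4.2(ii) gives `ν_c(g) = ν₀ᶜ(0,g̃₀)/(1+z₀ᶜ(0,g̃₀))` with `g̃₀ = g + O(g²)`,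
  `z₀ᶜ(0,g̃₀) = O(g)`, whence `ν_c(g) + ag = [(ν₀ᶜ + ag̃₀) + a(g - g̃₀) + agz₀ᶜ]/(1+z₀ᶜ) = O(g²)`
  with an explicit constant. With `BBS2015_prop42ii_of_lemA1`:
  `CTWSAW.BBS2015_thm12_of_thm41_nu0c_of_lemA1` (Theorem 1.2 from the RG input and Lemma A.1), and
  `CTWSAW.BBS2015_thm12_upper_of_thm41_nu0c_of_lemA1`.

Nothing else is asserted. Locators: Theorem 4.1, Proposition 4.2, Proposition 7.1 and §8.5 by
number/name; the displays of §8.5 by content (their numbers are not legible in the held text).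
-/

noncomputable section

open Set Filter Topology

namespace Literature.Barriers.CriticalPhenomena

namespace CTWSAW

/-- **Theorem 4.1 with the §8.5 asymptotics of the critical initial condition** (Bauerschmidt–
Brydges–Slade 2015): there are `δ > 0`, `K`, functions `ν₀ᶜ, z₀ᶜ : [0,δ)² → ℝ` and `c` with all the
conclusions of Theorem 4.1 (`Thm41Data δ K ν₀ᶜ z₀ᶜ c` of `…Reduction.lean`: `χ̂ = 1/m²` on the
critical surface, the `∂χ̂/∂ν₀` asymptotics, `ν₀ᶜ(m²,0) = z₀ᶜ(m²,0) = 0`, `O(1)` derivative bounds)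
AND, for the same `ν₀ᶜ` — in print the function `μ₀ᶜ` of Proposition 7.1, for which Theorem 4.1 is
proved in §8.4 — the conclusion of §8.5: "`μ₀ᶜ(0,g₀) = -2C(0)g₀ + O(g₀²) = -ag₀ + O(g₀²)` (all
covariances have `m² = 0` in this proof)", `C(0) = C₀(0) = greenZero 4`, i.e. there are `C` and
`δ₂ > 0` with `|ν₀ᶜ(0,g₀) + 2C₀(0)g₀| ≤ Cg₀²` for `0 < g₀ < δ₂`. Proved in print from the flow
equations of Proposition 7.1 and the perturbative coefficients of [BBS-rg-pt]
(`η_j = 2L^{2(j+1)}C_{j+1;0,0}`, `Σ_l C_{l+1;0,0} = C(0)`); not formalisable short of the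
renormalisation-group construction (Sections 5–8). Implies `BBS2015_thm41`
(`BBS2015_thm41_nu0c.thm41`).
[cite: BauerschmidtBrydgesSlade2015LogCorr, Theorem 4.1, Proposition 7.1 and §8.5 (proof of Theorem 1.2)] -/
def BBS2015_thm41_nu0c : Prop :=
  ∃ (δ K : ℝ) (ν₀c z₀c : ℝ → ℝ → ℝ) (c : ℝ → ℝ), Thm41Data δ K ν₀c z₀c c ∧
    ∃ C δ₂ : ℝ, 0 < δ₂ ∧ ∀ g₀ ∈ Ioo (0 : ℝ) δ₂, |ν₀c 0 g₀ + 2 * greenZero 4 * g₀| ≤ C * g₀ ^ 2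

/-- The bundled fact contains Theorem 4.1. [cite: BauerschmidtBrydgesSlade2015LogCorr, Theorem 4.1] -/
theorem BBS2015_thm41_nu0c.thm41 (h : BBS2015_thm41_nu0c) : BBS2015_thm41 := by
  obtain ⟨δ, K, ν₀c, z₀c, c, hD, -⟩ := h
  exact ⟨δ, K, ν₀c, z₀c, c, hD⟩

/-- `C₀(0) ≥ 0` (a `toReal`). [cite: BauerschmidtBrydgesSlade2015LogCorr, §1.2 (C₀(0))] -/
theorem greenZero_nonneg (d : ℕ) : 0 ≤ greenZero d :=
  ENNReal.toReal_nonneg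

/-- The elementary estimate of the §8.5 display: if `ν = ν₀/(1+z)` with `|z| ≤ 1/2`,
`|ν₀ + a g̃| ≤ R`, then `|ν + ag| ≤ 2(R + a|g - g̃| + ag|z|)` for `a, g ≥ 0`. [folklore] -/
theorem abs_div_add_le {ν₀ z a g gt R : ℝ} (hz : |z| ≤ 1 / 2) (ha : 0 ≤ a) (hg : 0 ≤ g)
    (hR : |ν₀ + a * gt| ≤ R) :
    |ν₀ / (1 + z) + a * g| ≤ 2 * (R + a * |g - gt| + a * g * |z|) := by
  have hz' : 1 / 2 ≤ 1 + z := by linarith [(abs_le.1 hz).1]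
  have hpos : 0 < 1 + z := by linarith
  have hkey : ν₀ / (1 + z) + a * g = ((ν₀ + a * gt) + a * (g - gt) + a * g * z) / (1 + z) := by
    field_simp
    ring
  rw [hkey, abs_div, abs_of_pos hpos, div_le_iff₀ hpos]
  have h1 : |(ν₀ + a * gt) + a * (g - gt) + a * g * z| ≤ R + a * |g - gt| + a * g * |z| := by
    calc |(ν₀ + a * gt) + a * (g - gt) + a * g * z|
        ≤ |(ν₀ + a * gt) + a * (g - gt)| + |a * g * z| := abs_add_le _ _
      _ ≤ |ν₀ + a * gt| + |a * (g - gt)| + |a * g * z| := by gcongr; exact abs_add_le _ _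
      _ = |ν₀ + a * gt| + a * |g - gt| + a * g * |z| := by
          rw [abs_mul, abs_of_nonneg ha, abs_mul, abs_mul, abs_of_nonneg ha, abs_of_nonneg hg]
      _ ≤ R + a * |g - gt| + a * g * |z| := by gcongr
  have hnn : 0 ≤ R + a * |g - gt| + a * g * |z| := (abs_nonneg _).trans h1
  nlinarith [h1, hnn, hz', abs_nonneg z]

/-- **Theorem 1.2 from the renormalisation-group input and Proposition 4.2(ii)** — the "Proof of
Theorem 1.2" paragraph of §8.5: with `g₀ = g̃₀(g,0)`, `ν_c(g) = ν₀ᶜ(0,g₀)/(1+z₀ᶜ(0,g₀))`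
(Proposition 4.2(ii) at `ε = 0`), `g₀ = g + O(g²)`, `z₀ᶜ(0,g₀) = O(g)` and
`ν₀ᶜ(0,g₀) = -ag₀ + O(g₀²)` give `ν_c(g) = -ag + O(g²)`, here with the explicit constant
`2(4|C| + 2a|K₁|)`, `a = 2C₀(0)`, for `0 < g < min(δ₁, δ₂/2, 1/(2|K₁|+2))`.
[cite: BauerschmidtBrydgesSlade2015LogCorr, §8.5 (proof of Theorem 1.2)] -/
theorem BBS2015_thm12_of_thm41_nu0c (h : BBS2015_thm41_nu0c) (h42 : BBS2015_prop42ii) :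
    BBS2015_thm12 := by
  obtain ⟨δ, K, ν₀c, z₀c, c, hD, C, δ₂, hδ₂, hasymp⟩ := h
  obtain ⟨δ₁, K₁, hδ₁, htraj⟩ := h42 δ K ν₀c z₀c c hD
  set a : ℝ := 2 * greenZero 4 with ha_def
  have ha : 0 ≤ a := by rw [ha_def]; exact mul_nonneg zero_le_two (greenZero_nonneg 4)
  clear_value a
  have hK₁2 : 0 < 2 * |K₁| + 2 := by positivity
  refine ⟨2 * (4 * |C| + 2 * a * |K₁|), min δ₁ (min (δ₂ / 2) (1 / (2 * |K₁| + 2))),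
    lt_min hδ₁ (lt_min (half_pos hδ₂) (by positivity)), fun g hg hglt => ?_⟩
  have hgδ₁ : g < δ₁ := hglt.trans_le (min_le_left _ _)
  have hgδ₂ : g < δ₂ / 2 := hglt.trans_le ((min_le_right _ _).trans (min_le_left _ _))
  have hg1 : g ≤ 1 / (2 * |K₁| + 2) := (hglt.trans_le ((min_le_right _ _).trans (min_le_right _ _))).le
  -- `|K₁| g ≤ 1/2`
  have hKg : |K₁| * g ≤ 1 / 2 := by
    calc |K₁| * g ≤ |K₁| * (1 / (2 * |K₁| + 2)) := by gcongr
      _ ≤ 1 / 2 := by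
          rw [mul_one_div, div_le_iff₀ hK₁2]
          nlinarith [abs_nonneg K₁]
  -- Proposition 4.2(ii) at `ε = 0`
  obtain ⟨ε₁, hε₁, mt, gt, hmt0, -, -, -, hall⟩ := htraj g ⟨hg, hgδ₁⟩
  obtain ⟨-, hgt, hgtg, hν₀, hz₀, -, hνc⟩ := hall 0 ⟨le_rfl, hε₁⟩
  rw [hmt0, add_zero, add_zero] at hνc
  rw [hmt0] at hν₀ hz₀
  set gt0 := gt 0 with hgt0
  -- `g̃₀ ≤ 2g < δ₂`
  have hgt_le : gt0 ≤ 2 * g := by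
    have h1 : gt0 - g ≤ |K₁| * g ^ 2 := (le_abs_self _).trans (hgtg.trans (by gcongr; exact le_abs_self _))
    nlinarith [hKg, hg]
  have hgt_mem : gt0 ∈ Ioo (0 : ℝ) δ₂ := ⟨hgt.1, by linarith⟩
  -- the §8.5 estimate
  have hz : |z₀c 0 gt0| ≤ 1 / 2 :=
    hz₀.trans ((mul_le_mul_of_nonneg_right (le_abs_self K₁) hg.le).trans hKg)
  have hR := hasymp gt0 hgt_mem
  have key := abs_div_add_le (ν₀ := ν₀c 0 gt0) hz ha hg.le hR
  rw [← hνc] at key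
  rw [← ha_def]
  refine key.trans ?_
  -- bound the three error terms by multiples of `g²`
  have e1 : C * gt0 ^ 2 ≤ 4 * |C| * g ^ 2 := by
    calc C * gt0 ^ 2 ≤ |C| * gt0 ^ 2 := by gcongr; exact le_abs_self C
      _ ≤ |C| * (2 * g) ^ 2 := by gcongr; exact hgt.1.le
      _ = 4 * |C| * g ^ 2 := by ring
  have e2 : a * |g - gt0| ≤ a * |K₁| * g ^ 2 := by
    rw [abs_sub_comm]
    calc a * |gt0 - g| ≤ a * (K₁ * g ^ 2) := mul_le_mul_of_nonneg_left hgtg ha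
      _ ≤ a * (|K₁| * g ^ 2) := by gcongr; exact le_abs_self _
      _ = a * |K₁| * g ^ 2 := by ring
  have e3 : a * g * |z₀c 0 gt0| ≤ a * |K₁| * g ^ 2 := by
    calc a * g * |z₀c 0 gt0| ≤ a * g * (K₁ * g) := by gcongr
      _ ≤ a * g * (|K₁| * g) := by gcongr; exact le_abs_self _
      _ = a * |K₁| * g ^ 2 := by ring
  nlinarith [e1, e2, e3]

/-- Theorem 1.2 from the renormalisation-group input `BBS2015_thm41_nu0c` and **Lemma A.1**
(Proposition 4.2(ii) being proved from Theorem 4.1 and Lemma A.1 in `…ChangeOfParameters.lean`).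
[cite: BauerschmidtBrydgesSlade2015LogCorr, §8.5 (proof of Theorem 1.2), Proposition 4.2, Lemma A.1] -/
theorem BBS2015_thm12_of_thm41_nu0c_of_lemA1 (h : BBS2015_thm41_nu0c) (hA : BBS2015_lemA1) :
    BBS2015_thm12 :=
  BBS2015_thm12_of_thm41_nu0c h (BBS2015_prop42ii_of_lemA1 hA)

/-- In particular the upper (renormalisation-group) inequality of Theorem 1.2 follows from
`BBS2015_thm41_nu0c` and Lemma A.1.
[cite: BauerschmidtBrydgesSlade2015LogCorr, §8.5 (proof of Theorem 1.2)] -/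
theorem BBS2015_thm12_upper_of_thm41_nu0c_of_lemA1 (h : BBS2015_thm41_nu0c) (hA : BBS2015_lemA1) :
    BBS2015_thm12_upper :=
  (BBS2015_thm12_of_thm41_nu0c_of_lemA1 h hA).upper

end CTWSAW

end Literature.Barriers.CriticalPhenomena
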